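import Literature.MathematicalPhysics.QuantumFieldTheory.Balaban1983to89.BlockAveragingEMLLinearised
import Literature.MathematicalPhysics.QuantumFieldTheory.Balaban1983to89.B10StarCount
import HarnessLib

/-!
# Route `UnitScaleTilt`, crux K1 «MinimiserStabilityRegPr» (stmt-QuantumFields-19200), route-R E′ S3, line HKGK-ANALYTIC (★★OWNER g28 22:42:33Z), item (C2-i) «LINAVG-ADJOINT»:
# ON COARSE-CO-CLOSED TEST FIELDS THE LINEARISED (0.4) AVERAGE PAIRS LIKE THE STRAIGHT BLOCK AVERAGE — THE STAIRS DROP OUT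
# `Σ_c ν(c)•(Q₁Y)(c) = Σ_c ν(c)•(L·(QY)(c))` whenever `Σ_μ ν⟨y,μ⟩ = Σ_μ ν⟨y−e_μ,μ⟩` at every coarse site `y`; and `Σ_c ν(c)•(Q₁(dλ))(c) = 0`

Cell `ym3-torus`, width seat `ym3-torus-px12` (gen 4); ★ym-ust-19200-w4 g7 (pen of the HKGK-ANALYTIC line) 2026-08-28 22:59:06Z «px12: LINAVG-ADJOINT GO»; LOCATE = my
`LOCATE-C2-FLAT-px12g4.md` §3 (C2-i) (19200 evidence).  THEOREMS ONLY (0 `def`, 0 `sorry`); `--supports stmt-QuantumFields-19200 --as helper`, count-neutral.  YM₃ on T³ is a ladder rung (R3),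
not the Clay problem; nothing here claims the stub, the crux, d = 4 or the mass gap.

THE POINT (★w4 g7 `LOCATE-B1-BERNSTEIN-w4g7.md` §0 item 1).  ✓ `BlockAveragingEMLLinearised.linAvg_eq_bondAvg_sub_grad_combMean` says the flat one-step linearisation `Q₁` of the (0.4)
average of record is `L·bondAvg − δ∘combMean` — straight part minus a COARSE GRADIENT of the stair functional.  Pairing against a coarse bond weight `ν` and summing by parts on the
coarse torus, the gradient term becomes `−Σ_y (δᵀν)(y)•combMean Y y`; so on COARSE-CO-CLOSED `ν` (`δᵀν = 0`, i.e. `Σ_μ ν⟨y,μ⟩ = Σ_μ ν⟨y − e_μ, μ⟩`) it vanishes: `Q₁ᵀν = L·Qᵀν` — boxes and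
tents, no staircases.  The critical background's multiplier IS coarse-co-closed (memo 1 A1 ∕ LOCATE-B1 §0.1), which is why (C5) may read `𝒦A = Q₁ᵀν` through the straight average alone.
Likewise ✓ `linAvg_grad` (`Q₁(dλ)(c) = λ(emb c₊) − λ(emb c₋)`) gives `Σ_c ν(c)•Q₁(dλ)(c) = 0`: `GᵀQ₁ᵀν = 0`, the image is fine-co-closed.

WHAT IS PROVED (ns `…Theorems.Prop7LinAvgAdjoint`; any `P : Params`, level `j`; weights `ν : PBond P k → R` in any ring `R` acting on any `R`-module `M` — so scalar `ℂ`-weights on matrix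
fields AND matrix weights by left multiplication are both covered).
* §1 ★ `sum_smul_coarseGrad_eq_zero` — the coarse summation by parts: `(∀ y, Σ_μ ν⟨y,μ⟩ = Σ_μ ν⟨y−e_μ,μ⟩) ⇒ Σ_c ν(c)•(f(c₊) − f(c₋)) = 0` for EVERY coarse site function `f`;
  `sum_smul_tgt_eq_sum_smul_unshift` (the reindexing `c ↦ (c₊, dir)` behind it).
* §2 ★★ `sum_smul_linAvg_eq_of_coclosed` — `Σ_c ν(c)•linAvg Y c = Σ_c ν(c)•((L:ℂ)•bondAvg Y c)` (matrix-valued `Y`, `ℂ`-weights); ★ `sum_smul_linAvg_grad_eq_zero` —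
  `Σ_c ν(c)•linAvg (dλ) c = 0`; ★★ `sum_mul_linAvg_eq_of_coclosed` ∕ `sum_mul_linAvg_grad_eq_zero` — the same with MATRIX weights `ν(c)·(…)` (left multiplication), co-closedness as matrices.
HONEST SCOPE.  Finite summation by parts on the coarse torus over two landed identities; flat, one step; no estimate.  The k-fold sentence (C2-ii) and the `bondAvg ↔ QvOp` carrier bridge
(C2-iii) are separate files.

References: T. Bałaban, CMP 98 (1985) 17–51 [Balaban1985Averaging] ((62) p.28, (124)–(125) p.36); CMP 95 (1984) 17–40 [Balaban1984PropagatorsI] ((1.11) p.19, (1.18) p.20, (1.21) p.21);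
CMP 109 (1987) 249–301 [Balaban1987RG1] ((0.4) p.253).
-/

set_option autoImplicit false

noncomputable section

open scoped BigOperators

namespace Summit.QuantumFields.YangMills.Theorems.Prop7LinAvgAdjoint

open Literature.MathematicalPhysics.QuantumFieldTheory.Balaban1983to89
open BlockAveragingEMLLinearised (linAvg combMean linAvg_eq_bondAvg_sub_grad_combMean linAvg_grad)
open LatticeFieldCalculus (bondAvg)
open B10StarCount (sum_pbond shiftEquiv shift_unshift unshift_shift)

variable {P : Params} {k : ℕ}

/-! ## §1 Coarse summation by parts against a co-closed weight -/

section SBP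

variable {R M : Type*} [Ring R] [AddCommGroup M] [Module R M]

/-- Reindexing the target sum: `Σ_c ν(c)•f(c₊) = Σ_y (Σ_μ ν⟨y − e_μ, μ⟩)•f(y)` (the bond `⟨y − e_μ, μ⟩` is the one ENDING at `y` in direction `μ`). [folklore] -/
theorem sum_smul_tgt_eq_sum_smul_unshift (ν : PBond P k → R) (f : Site P k → M) :
    ∑ c : PBond P k, ν c • f c.tgt = ∑ y : Site P k, (∑ μ : Fin P.d, ν ⟨y.unshift μ, μ⟩) • f y := by
  rw [sum_pbond]
  simp only [Finset.sum_smul]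
  rw [Finset.sum_comm]
  conv_rhs => rw [Finset.sum_comm]
  refine Finset.sum_congr rfl fun μ _ => ?_
  -- `Σ_x ν⟨x,μ⟩•f(x+e_μ) = Σ_y ν⟨y−e_μ,μ⟩•f(y)` by `y = x + e_μ`
  have h := Equiv.sum_comp (shiftEquiv (P := P) (i := k) μ) (fun y => ν ⟨y.unshift μ, μ⟩ • f y)
  rw [← h]
  refine Finset.sum_congr rfl fun x _ => ?_
  show ν ⟨x, μ⟩ • f (PBond.tgt ⟨x, μ⟩) = ν ⟨(x.shift μ).unshift μ, μ⟩ • f (x.shift μ)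
  rw [unshift_shift]
  rfl

/-- The source sum: `Σ_c ν(c)•f(c₋) = Σ_y (Σ_μ ν⟨y, μ⟩)•f(y)`. [folklore] -/
theorem sum_smul_src_eq (ν : PBond P k → R) (f : Site P k → M) :
    ∑ c : PBond P k, ν c • f c.src = ∑ y : Site P k, (∑ μ : Fin P.d, ν ⟨y, μ⟩) • f y := by
  rw [sum_pbond]
  simp only [Finset.sum_smul]

/-- ★ **COARSE SUMMATION BY PARTS AGAINST A CO-CLOSED WEIGHT**: if `Σ_μ ν⟨y,μ⟩ = Σ_μ ν⟨y − e_μ, μ⟩` at every coarse site `y` (`δᵀν = 0`), then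
`Σ_c ν(c)•(f(c₊) − f(c₋)) = 0` for EVERY coarse site function `f`. [cite: Balaban1984PropagatorsI, (1.21) p.21] -/
theorem sum_smul_coarseGrad_eq_zero (ν : PBond P k → R)
    (hν : ∀ y : Site P k, ∑ μ : Fin P.d, ν ⟨y, μ⟩ = ∑ μ : Fin P.d, ν ⟨y.unshift μ, μ⟩) (f : Site P k → M) :
    ∑ c : PBond P k, ν c • (f c.tgt - f c.src) = 0 := by
  simp only [smul_sub, Finset.sum_sub_distrib]
  rw [sum_smul_tgt_eq_sum_smul_unshift, sum_smul_src_eq, ← Finset.sum_sub_distrib]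
  refine Finset.sum_eq_zero fun y _ => ?_
  rw [← hν y, sub_self]

end SBP

/-! ## §2 The linearised (0.4) average against co-closed weights: scalar weights -/

section Scalar

variable {j : ℕ} {n : Type*}

/-- ★★ **THE STAIRS DROP OUT**: for a coarse-co-closed scalar weight `ν` (`Σ_μ ν⟨y,μ⟩ = Σ_μ ν⟨y − e_μ, μ⟩` ∀ `y`) and every matrix bond field `Y`,
`Σ_c ν(c)•(Q₁Y)(c) = Σ_c ν(c)•(L·(QY)(c))` — the linearised (0.4) average pairs like `L` times the straight block average (1.11).
[cite: Balaban1985Averaging, (124)-(125) p.36; Balaban1984PropagatorsI, (1.11) p.19] -/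
theorem sum_smul_linAvg_eq_of_coclosed (ν : PBond P (j + 1) → ℂ)
    (hν : ∀ y : Site P (j + 1), ∑ μ : Fin P.d, ν ⟨y, μ⟩ = ∑ μ : Fin P.d, ν ⟨y.unshift μ, μ⟩)
    (Y : PBond P j → Matrix n n ℂ) :
    ∑ c : PBond P (j + 1), ν c • linAvg Y c = ∑ c : PBond P (j + 1), ν c • (((P.L : ℕ) : ℂ) • bondAvg Y c) := by
  have h0 := sum_smul_coarseGrad_eq_zero (R := ℂ) (M := Matrix n n ℂ) ν hν (combMean Y)
  calc ∑ c : PBond P (j + 1), ν c • linAvg Y c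
      = ∑ c : PBond P (j + 1), (ν c • (((P.L : ℕ) : ℂ) • bondAvg Y c) - ν c • (combMean Y c.tgt - combMean Y c.src)) := by
        refine Finset.sum_congr rfl fun c _ => ?_
        rw [linAvg_eq_bondAvg_sub_grad_combMean, smul_sub]
    _ = ∑ c : PBond P (j + 1), ν c • (((P.L : ℕ) : ℂ) • bondAvg Y c) := by
        rw [Finset.sum_sub_distrib, h0, sub_zero]

/-- ★ **THE IMAGE IS FINE-CO-CLOSED**: for a coarse-co-closed scalar weight `ν` and every site function `λ`, `Σ_c ν(c)•Q₁(dλ)(c) = 0` (`(dλ)_b = λ(b₊) − λ(b₋)`;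
✓ `linAvg_grad`: `Q₁(dλ)(c) = λ(emb c₊) − λ(emb c₋)`). [cite: Balaban1985Averaging, (11) p.18] -/
theorem sum_smul_linAvg_grad_eq_zero (ν : PBond P (j + 1) → ℂ)
    (hν : ∀ y : Site P (j + 1), ∑ μ : Fin P.d, ν ⟨y, μ⟩ = ∑ μ : Fin P.d, ν ⟨y.unshift μ, μ⟩)
    (lam : Site P j → Matrix n n ℂ) :
    ∑ c : PBond P (j + 1), ν c • linAvg (fun b : PBond P j => lam b.tgt - lam b.src) c = 0 := by
  have h0 := sum_smul_coarseGrad_eq_zero (R := ℂ) (M := Matrix n n ℂ) ν hν (fun y => lam (emb y))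
  calc ∑ c : PBond P (j + 1), ν c • linAvg (fun b : PBond P j => lam b.tgt - lam b.src) c
      = ∑ c : PBond P (j + 1), ν c • (lam (emb c.tgt) - lam (emb c.src)) := by
        refine Finset.sum_congr rfl fun c _ => ?_
        rw [linAvg_grad]
    _ = 0 := h0

end Scalar

/-! ## §3 The same with matrix weights (left multiplication; colour mixing allowed) -/

section MatrixWeights

variable {j : ℕ} {n : Type*} [Fintype n] [DecidableEq n]

/-- ★★ **STAIRS DROP OUT, MATRIX WEIGHTS**: for a coarse-co-closed matrix weight `ν` (co-closedness as matrices) and every matrix bond field `Y`,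
`Σ_c ν(c)·(Q₁Y)(c) = Σ_c ν(c)·(L·(QY)(c))`. [cite: Balaban1985Averaging, (124)-(125) p.36; Balaban1984PropagatorsI, (1.11) p.19] -/
theorem sum_mul_linAvg_eq_of_coclosed (ν : PBond P (j + 1) → Matrix n n ℂ)
    (hν : ∀ y : Site P (j + 1), ∑ μ : Fin P.d, ν ⟨y, μ⟩ = ∑ μ : Fin P.d, ν ⟨y.unshift μ, μ⟩)
    (Y : PBond P j → Matrix n n ℂ) :
    ∑ c : PBond P (j + 1), ν c * linAvg Y c = ∑ c : PBond P (j + 1), ν c * (((P.L : ℕ) : ℂ) • bondAvg Y c) := by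
  have h0 := sum_smul_coarseGrad_eq_zero (R := Matrix n n ℂ) (M := Matrix n n ℂ) ν hν (combMean Y)
  simp only [smul_eq_mul] at h0
  calc ∑ c : PBond P (j + 1), ν c * linAvg Y c
      = ∑ c : PBond P (j + 1), (ν c * (((P.L : ℕ) : ℂ) • bondAvg Y c) - ν c * (combMean Y c.tgt - combMean Y c.src)) := by
        refine Finset.sum_congr rfl fun c _ => ?_
        rw [linAvg_eq_bondAvg_sub_grad_combMean, mul_sub]
    _ = ∑ c : PBond P (j + 1), ν c * (((P.L : ℕ) : ℂ) • bondAvg Y c) := by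
        rw [Finset.sum_sub_distrib, h0, sub_zero]

/-- ★ **FINE-CO-CLOSED IMAGE, MATRIX WEIGHTS**: `Σ_c ν(c)·Q₁(dλ)(c) = 0` for coarse-co-closed matrix weights. [cite: Balaban1985Averaging, (11) p.18] -/
theorem sum_mul_linAvg_grad_eq_zero (ν : PBond P (j + 1) → Matrix n n ℂ)
    (hν : ∀ y : Site P (j + 1), ∑ μ : Fin P.d, ν ⟨y, μ⟩ = ∑ μ : Fin P.d, ν ⟨y.unshift μ, μ⟩)
    (lam : Site P j → Matrix n n ℂ) :
    ∑ c : PBond P (j + 1), ν c * linAvg (fun b : PBond P j => lam b.tgt - lam b.src) c = 0 := by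
  have h0 := sum_smul_coarseGrad_eq_zero (R := Matrix n n ℂ) (M := Matrix n n ℂ) ν hν (fun y => lam (emb y))
  simp only [smul_eq_mul] at h0
  calc ∑ c : PBond P (j + 1), ν c * linAvg (fun b : PBond P j => lam b.tgt - lam b.src) c
      = ∑ c : PBond P (j + 1), ν c * (lam (emb c.tgt) - lam (emb c.src)) := by
        refine Finset.sum_congr rfl fun c _ => ?_
        rw [linAvg_grad]
    _ = 0 := h0

end MatrixWeights

end Summit.QuantumFields.YangMills.Theorems.Prop7LinAvgAdjoint

end
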